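import Literature.Barriers.ValiantsHypothesis.NotViaSaturations
import Literature.Computability.AlgebraicComplexity.KumarLatinRectangles
import HarnessLib

/-!
# Discharge of `Kumar2015_stretching` (Bürgisser–Hüttenhain–Ikenmeyer 2017, Thm. 2 = Kumar 2015,
# Cor. 6.2): conditionally on Alon–Tarsi, `n λ ∈ S(Det_n)` for every partition `λ` with `ℓ(λ) ≤ n`

`Literature.Barriers.ValiantsHypothesis.Kumar2015_stretching` (file `NotViaSaturations.lean`) is
BHI's Theorem 2: "Let `n` be even. If the Alon-Tarsi conjecture for `n × n` latin squares holds,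
then `nλ ∈ S(Det_n)` for all partitions `λ` such that `ℓ(λ) ≤ n`", attributed there to S. Kumar,
*A study of the representations supported by the orbit closure of the determinant*, Compositio
Math. 151 (2015) 292–312 (= arXiv:1109.5996), where it is Cor. 6.2 of Thm. 6.1 via the column
Latin square conjecture (Conj. 4.3) and its equivalence with Alon–Tarsi (Rem. 4.5, Huang–Rota
1994). This file proves it (`Kumar2015_stretching_holds`), following Kumar's architecture in the
tree's conventions (determinant size `m`, `S(Det_m) = detOccWeights m`, weights of `GL_{m²}` in
the coordinate-ring convention of `coordRep`):

1. **The highest-weight vector `P_i` (Kumar §2, Lemma 2.7; unique up to scalar, Howe).** In the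
   tree this is Cayley's hyperdeterminant polynomial `hyperdetPoly m t` on the top `i` matrix
   letters `t = topLetters m i` (`Hyperdeterminant.lean`, built for BIP Prop. 2.3): a highest-weight
   vector of `ℂ[Sym^m ℂ^{m²}]` of weight `rectWeight m t` = the dual of the rectangle `i × m = m δ_i`
   (`hyperdetPoly_mem_highestWeightSpace`), whose value at a form `q` is the hyperdeterminant of the
   symmetric array of `q` on the letters (`aeval_formCoeff_hyperdetPoly`).
2. **Kumar's evaluation map `θ` (§3) and Prop. 3.2/Thm. 6.1.** At the product of linear forms
   `q_c = ∏_{r<m} ∑_{a<i} c_{r,a} x_{t a}` (Kumar's `θ(A) = det ∘ Â` restricted to `E_i`, a point of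
   `End · det_m ⊆ Ω_m`: `linProd_mem_orbitClosure_detFormLex`) the array is the symmetrisation
   `w̄(J) = (m!)⁻¹ ∑_π ∏_r c_{r, J(π r)}` (`arrOf_linProd`) and the hyperdeterminant is
   `(m!)^{-i} · designPoly i m (c)` (`hyperdet_arrOf_linProd`), the design polynomial of
   `KumarLatinRectangles.lean`, whose multilinear coefficient is `∑_𝒜 (♯L⁺_𝒜 − ♯L⁻_𝒜)²` (Kumar
   Prop. 5.2) and which is therefore nonzero for all `i ≤ m` once `♯CELS(m) ≠ ♯COLS(m)` (Lemma 4.2,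
   Thm. 5.6). A nonzero integer polynomial has a complex non-root (`MvPolynomial.funext`), so `P_i`
   does not vanish on `Ω_m` and `m δ_i` occurs in `ℂ[Ω_m]` for `1 ≤ i ≤ m`
   (`hasHighestWeight_detOrbitRep_rectWeight`; Kumar Thm. 6.1).
3. **Huang–Rota (Kumar Rem. 4.5): Alon–Tarsi ⇒ column Latin square conjecture.** For every Latin
   square the product of the row, column and symbol parities is the constant `sgn(τ)`, `τ` the
   coordinate swap on `[n] × [n]` (the identity `π_r + π_c + π_s ≡ \binom{n}{2} (mod 2)`, "rediscovered
   numerous times", Francetić–Herke–Wanless 2018 (1.1)); here from the cells permutations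
   `(i,j) ↦ (i, L_{ij})`, `(i,j) ↦ (L_{ij}, j)` (`colSign_rowInv`). With the parastrophe `L ↦ L*`
   inverting the rows, which exchanges column and symbol signs, the column-signed count of Latin
   squares equals `sgn(τ)` times the Alon–Tarsi signed count (`sum_colSign_eq`), so
   `AlonTarsiConjecture m ↔ latinColCount m ≠ 0` (`latinColCount_ne_zero_iff`).
4. **The monoid (Kumar Cor. 6.2).** `m · λ = ∑_i (λ_i − λ_{i+1}) · (m δ_i)` in weight coordinates
   (`smul_ofPartition_eq_sum`) and `detOccWeights m` is an additive monoid (BIP Lemma 2.2, tree).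

The hypothesis `Even m` of the statement is not used: for odd `m ≥ 3` the Alon–Tarsi signed count
vanishes, so the implication holds vacuously there; `m = 0` is the degenerate true instance.

## References

* [BurgisserHuttenhainIkenmeyer2017] P. Bürgisser, J. Hüttenhain, C. Ikenmeyer, Proc. AMS 145
  (2017) 1247–1258, Thm. 2 and §1.1.
* [Kumar2015] S. Kumar, Compositio Math. 151 (2015) 292–312: §2 (Lemma 2.7, Cor. 2.4), §3 (θ,
  Lemma 3.1, Prop. 3.2), §4 (Def. 4.1, Lemma 4.2, Conj. 4.3, Prop. 4.4, Rem. 4.5), §5 (Prop. 5.2,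
  Thm. 5.6), §6 (Thm. 6.1, Cor. 6.2).
* [HuangRota1994] R. Huang, G.-C. Rota, Discrete Math. 128 (1994) 225–236 (Alon–Tarsi ⇔ column
  Latin square conjecture; cited through Kumar Rem. 4.5).
* [FranceticHerkeWanless2018] N. Francetić, S. Herke, I. M. Wanless, JCTA 155 (2018) 67–99, (1.1)
  and Lemma 2.6 (the relation between the three parities of a Latin square).

## Tree

`hyperdetPoly`, `hyperdet`, `arrOf`, `arrOf_sum_C_mul_prod_X`, `aeval_formCoeff_hyperdetPoly`,
`hyperdetPoly_mem_highestWeightSpace`, `rectWeight` (`Hyperdeterminant.lean`); `topLetters`,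
`aeval_formCoeff_eq_zero_of_mem_orbitClosure_detFormLex`, `hasHighestWeight_orbitCoordRep_of_not_mem`,
`detOccWeights`, `mem_detOccWeights_iff`, `antitone_getD_sortedParts` (`OccurrenceObstructionsBIP.lean`);
`det_mem_endOrbit_detPoly` (`PaddedPowerSums.lean`), `endOrbit_subset_orbitClosure_holds`,
`rename_mem_orbitClosure_rename_iff_holds`; the Latin-rectangle combinatorics and `designPoly` of
`KumarLatinRectangles.lean`; `IsLatinSquare`, `latinSign`, `AlonTarsiConjecture`,
`Kumar2015_stretching` of `NotViaSaturations.lean`.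
-/

noncomputable section

open Equiv Finset MvPolynomial

namespace Literature.Barriers.ValiantsHypothesis

open Literature.NumberTheory.DiophantineGeometry Literature.Computability.AlgebraicComplexity
  Literature.Computability.AlgebraicComplexity.Kumar2015 Literature.Computability.Complexity

/-! ### Kumar's evaluation: the array and the hyperdeterminant of a product of linear forms -/

section Chow

variable {k : Type*} [Field k] {τ : Type*} {i m : ℕ}

/-- The weight `w(f) = ∏_r c_{r, f r}` of a choice `f : [m] → [i]` of one letter from each linear
form `L_r = ∑_a c_{r,a} x_{t a}` (expansion of `∏_r L_r`). [cite: Kumar2015, §3 (the expansion of θ(A))] -/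
def wOf (c : Fin m × Fin i → k) (f : Fin m → Fin i) : k := ∏ r, c (r, f r)

/-- Its symmetrisation `w̄(f) = (m!)⁻¹ ∑_{π ∈ S_m} w(f ∘ π)` (Kumar's `(1/m!) ∑ Perm(…)`).
[cite: Kumar2015, §3 (the symmetrisation π)] -/
def wBar (c : Fin m × Fin i → k) (f : Fin m → Fin i) : k :=
  ((Nat.factorial m : k))⁻¹ * ∑ π : Perm (Fin m), wOf c (f ∘ ⇑π)

/-- `w̄` is symmetric. [folklore] -/
theorem wBar_comp_perm (c : Fin m × Fin i → k) (f : Fin m → Fin i) (π₀ : Perm (Fin m)) :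
    wBar c (f ∘ ⇑π₀) = wBar c f := by
  unfold wBar
  congr 1
  exact Fintype.sum_equiv (Equiv.mulLeft π₀) _ _ fun π => rfl

/-- **Kumar's point `θ(A)`**: the product of the linear forms `L_r = ∑_a c_{r,a} x_{t a}`, `r < m`,
in the letters `t` ("`θ(A)(∑_j λ_j e_j) = ∏_{p=1}^m (∑_j λ_j a^j_p)`"). [cite: Kumar2015, §3 (θ, before Lemma 3.1)] -/
def linProd (c : Fin m × Fin i → k) (t : Fin i → τ) : MvPolynomial τ k :=
  ∏ r : Fin m, ∑ a : Fin i, c (r, a) • X (t a)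

/-- Expansion of the product of linear forms over choice functions. [folklore] -/
theorem linProd_eq_sum_wOf (c : Fin m × Fin i → k) (t : Fin i → τ) :
    linProd c t = ∑ f : Fin m → Fin i, C (wOf c f) * ∏ r, X (t (f r)) := by
  unfold linProd wOf
  rw [Finset.prod_univ_sum]
  refine Finset.sum_congr rfl fun f _ => ?_
  simp only [smul_eq_C_mul, Finset.prod_mul_distrib, map_prod]

/-- The product of linear forms is the symmetrised expansion (characteristic zero). [folklore] -/
theorem linProd_eq_sum_wBar [CharZero k] (c : Fin m × Fin i → k) (t : Fin i → τ) :
    linProd c t = ∑ f : Fin m → Fin i, C (wBar c f) * ∏ r, X (t (f r)) := by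
  have hinv : ∀ π : Perm (Fin m), ∑ f : Fin m → Fin i, C (wOf c (f ∘ ⇑π)) * ∏ r, X (t (f r)) =
      ∑ f : Fin m → Fin i, C (wOf c f) * ∏ r, (X (t (f r)) : MvPolynomial τ k) := by
    intro π
    refine Fintype.sum_equiv (π.symm.arrowCongr (Equiv.refl (Fin i))) _ _ fun f => ?_
    have hf : (π.symm.arrowCongr (Equiv.refl (Fin i))) f = f ∘ ⇑π := by
      funext r; simp [Equiv.arrowCongr_apply]
    rw [hf]
    congr 1
    simp only [Function.comp_apply]
    exact (Equiv.prod_comp π (fun r => (X (t (f r)) : MvPolynomial τ k))).symm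
  unfold wBar
  simp only [map_mul, map_sum, Finset.mul_sum, Finset.sum_mul, mul_assoc]
  rw [Finset.sum_comm]
  simp only [← Finset.mul_sum, hinv, Finset.sum_const, Finset.card_univ, Fintype.card_perm,
    Fintype.card_fin, nsmul_eq_mul]
  rw [← mul_assoc, ← map_natCast (C : k →+* MvPolynomial τ k), ← map_mul,
    inv_mul_cancel₀ (Nat.cast_ne_zero.mpr (Nat.factorial_ne_zero m)), map_one, one_mul,
    linProd_eq_sum_wOf]

/-- The symmetric extension of `w̄` to all words in the variables (zero off the words in the
letters `t`). [folklore] -/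
def arrExt [DecidableEq τ] (c : Fin m × Fin i → k) (t : Fin i → τ) (I : Fin m → τ) : k :=
  ∑ f : Fin m → Fin i, if I = t ∘ f then wBar c f else 0

/-- `arrExt` is symmetric. [folklore] -/
theorem arrExt_comp_perm [DecidableEq τ] (c : Fin m × Fin i → k) (t : Fin i → τ)
    (I : Fin m → τ) (π : Perm (Fin m)) : arrExt c t (I ∘ ⇑π) = arrExt c t I := by
  unfold arrExt
  refine Fintype.sum_equiv (π.arrowCongr (Equiv.refl (Fin i))) _ _ fun f => ?_
  have hf : (π.arrowCongr (Equiv.refl (Fin i))) f = f ∘ ⇑π.symm := by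
    funext r; simp [Equiv.arrowCongr_apply]
  rw [hf, wBar_comp_perm]
  congr 1
  apply propext
  constructor
  · intro h; funext r
    have := congrFun h (π.symm r)
    simpa using this
  · intro h; funext r
    simp [h]

/-- The symmetrisation of `arrExt` is the symmetrised expansion. [folklore] -/
theorem sum_arrExt [Fintype τ] [DecidableEq τ] (c : Fin m × Fin i → k) (t : Fin i → τ) :
    ∑ I : Fin m → τ, C (arrExt c t I) * ∏ j, X (I j) =
      ∑ f : Fin m → Fin i, C (wBar c f) * ∏ r, (X (t (f r)) : MvPolynomial τ k) := by
  unfold arrExt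
  simp only [map_sum, Finset.sum_mul]
  rw [Finset.sum_comm]
  refine Finset.sum_congr rfl fun f _ => ?_
  simp only [apply_ite C, map_zero, ite_mul, zero_mul, Finset.sum_ite_eq', Finset.mem_univ,
    if_true]
  rfl

/-- **The symmetric array of `θ(A)` on the letters** (Kumar §3, the displayed computation of the
image of `f|_{E_i}` under `θ^{⊗m'} ∘ π^*`): `A(∏_r L_r)_{t∘J} = w̄(J) = (m!)⁻¹ ∑_π ∏_r c_{r, J(π r)}`
(`t` injective, characteristic zero). [cite: Kumar2015, §3 (the computation before Lemma 3.1)] -/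
theorem arrOf_linProd [Fintype τ] [DecidableEq τ] [CharZero k] (c : Fin m × Fin i → k)
    {t : Fin i → τ} (ht : Function.Injective t) (J : Fin m → Fin i) :
    arrOf m (linProd c t) (t ∘ J) = wBar c J := by
  rw [linProd_eq_sum_wBar, ← sum_arrExt, arrOf_sum_C_mul_prod_X (arrExt_comp_perm c t), arrExt,
    Finset.sum_eq_single J]
  · rw [if_pos rfl]
  · intro f _ hf
    exact if_neg fun h => hf (ht.comp_left h).symm
  · exact fun h => absurd (Finset.mem_univ J) h

/-- **Kumar's evaluation of `P_i` at `θ(A)`** (Prop. 3.2 / Thm. 6.1 in coordinates): the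
hyperdeterminant of the array of `∏_r L_r` on the letters is `(m!)^{-i}` times the design polynomial
at `c`. [cite: Kumar2015, Prop. 3.2 and Thm. 6.1 (proof)] -/
theorem hyperdet_arrOf_linProd [Fintype τ] [DecidableEq τ] [CharZero k] (c : Fin m × Fin i → k)
    {t : Fin i → τ} (ht : Function.Injective t) :
    hyperdet (fun J : Fin m → Fin i => arrOf m (linProd c t) (t ∘ J)) =
      ((Nat.factorial m : k))⁻¹ ^ i * aeval c (designPoly i m) := by
  simp only [arrOf_linProd c ht]
  unfold hyperdet designPoly
  rw [map_sum, Finset.mul_sum]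
  refine Finset.sum_congr rfl fun σ _ => ?_
  rw [map_sum, Finset.mul_sum]
  simp only [wBar, wOf, Function.comp_def]
  rw [Finset.prod_mul_distrib, Finset.prod_const, Finset.card_univ, Fintype.card_fin,
    Finset.prod_univ_sum, Finset.mul_sum, Finset.mul_sum]
  refine Finset.sum_congr rfl fun π _ => ?_
  have hC : aeval c (C ((∏ j, Perm.sign (σ j) : ℤˣ) : ℤ) : MvPolynomial (Fin m × Fin i) ℤ) =
      ∏ j, ((Perm.sign (σ j) : ℤ) : k) := by
    rw [aeval_C]
    push_cast
    rfl
  rw [map_mul, hC]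
  simp only [map_prod, aeval_X]
  ring

end Chow

/-! ### Rectangles occur in `ℂ[Ω_m]` (Kumar Thm. 6.1) -/

section Occurrence

variable {i m : ℕ}

/-- **`θ(A) ∈ Ω_m`**: the product of linear forms `∏_r L_r` in the `m²` matrix variables is the
determinant of the diagonal matrix `diag(L_r)`, a linear substitution instance of `det_m`
(`det_mem_endOrbit_detPoly`), hence lies in `End · det_m ⊆ Ω_m` (Kumar: "Clearly,
`Im θ̂ ⊂ 𝒳`"). [cite: Kumar2015, Thm. 6.1 (proof, Im θ̂ ⊂ 𝒳)] -/
theorem linProd_mem_orbitClosure_detFormLex (c : Fin m × Fin i → ℂ) (t : Fin i → MatIdx m) :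
    linProd c t ∈ orbitClosure (detFormLex ℂ m) := by
  classical
  -- the linear forms in the plain matrix variables
  set L' : Fin m → MvPolynomial (Fin m × Fin m) ℂ := fun r => ∑ a, c (r, a) • X (ofLex (t a))
    with hL'
  have hL'hom : ∀ r, (L' r).IsHomogeneous 1 := fun r =>
    IsHomogeneous.sum _ _ _ fun a _ => by
      rw [smul_eq_C_mul]; exact (isHomogeneous_X ℂ _).C_mul _
  have hdet : (Matrix.diagonal L').det = ∏ r, L' r := Matrix.det_diagonal
  have hmem : ∏ r, L' r ∈ orbitClosure (detPoly (Fin m) ℂ) := by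
    rw [← hdet]
    refine endOrbit_subset_orbitClosure_holds _ (det_mem_endOrbit_detPoly _ fun r s => ?_)
    by_cases hrs : r = s
    · subst hrs; rw [Matrix.diagonal_apply_eq]; exact hL'hom r
    · rw [Matrix.diagonal_apply_ne _ hrs]; exact isHomogeneous_zero _ _ _
  have hren : rename (toLex : Fin m × Fin m → MatIdx m) (∏ r, L' r) = linProd c t := by
    rw [map_prod]
    unfold linProd
    refine Finset.prod_congr rfl fun r _ => ?_
    simp only [hL', map_sum]
    refine Finset.sum_congr rfl fun a _ => ?_
    rw [map_smul, rename_X, toLex_ofLex]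
  rw [← hren, detFormLex]
  exact (rename_mem_orbitClosure_rename_iff_holds toLex (detPoly (Fin m) ℂ) _).mpr hmem

/-- **Kumar, Thm. 6.1 (the rectangles `m δ_i` occur in `ℂ[Ω_m]`), unconditional form.** If the
column-signed count of Latin squares of order `m` is nonzero, then for every `i ≤ m` the weight
`rectWeight m t` (`-m` on the top `i` matrix letters `t`, the dual of the rectangle `i × m = m δ_i`)
occurs in `ℂ[Ω_m]`: the highest-weight vector `P_i = hyperdetPoly m t` (Kumar's `γ_{m,i}`) takes at
the point `θ(A) = ∏_r L_r ∈ Ω_m` the value `(m!)^{-i} designPoly(c) ≠ 0` for a suitable complex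
`c` (the design polynomial is a nonzero integer polynomial, `designPoly_ne_zero_of_latinColCount_ne_zero`,
and `ℂ` is infinite, `MvPolynomial.funext`), so `P_i ∉ I(GL · det_m)`.
[cite: Kumar2015, Thm. 6.1] -/
theorem hasHighestWeight_detOrbitRep_rectWeight (m i : ℕ) (hi : i ≤ m * m) (him : i ≤ m)
    (hm : latinColCount m ≠ 0) :
    HasHighestWeight (detOrbitRep ℂ m) (rectWeight m (topLetters m i hi)) := by
  classical
  have hF := hyperdetPoly_mem_highestWeightSpace (k := ℂ) (ℓ := m) (topLetters_strictMono m i hi)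
    (topLetters_upper m i hi)
  refine hasHighestWeight_orbitCoordRep_of_not_mem _ m hF ?_
  -- a Chow point where the hyperdeterminant does not vanish
  have hP : designPoly i m ≠ 0 := designPoly_ne_zero_of_latinColCount_ne_zero hm him
  obtain ⟨c, hc⟩ : ∃ c : Fin m × Fin i → ℂ, aeval c (designPoly i m) ≠ 0 := by
    by_contra hcon
    push Not at hcon
    apply hP
    apply MvPolynomial.map_injective (Int.castRingHom ℂ) Int.cast_injective
    rw [map_zero]
    apply MvPolynomial.funext
    intro c
    rw [eval_map, map_zero]
    have := hcon c
    rwa [aeval_def, algebraMap_int_eq] at this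
  have hval : aeval (formCoeff m (linProd c (topLetters m i hi)))
      (hyperdetPoly m (topLetters m i hi) : MvPolynomial (DegIdx (MatIdx m) m) ℂ) ≠ 0 := by
    rw [aeval_formCoeff_hyperdetPoly,
      hyperdet_arrOf_linProd c (topLetters_strictMono m i hi).injective]
    exact mul_ne_zero (pow_ne_zero _ (inv_ne_zero (Nat.cast_ne_zero.mpr
      (Nat.factorial_ne_zero m)))) hc
  intro hI
  exact hval (aeval_formCoeff_eq_zero_of_mem_orbitClosure_detFormLex
    (linProd_mem_orbitClosure_detFormLex c _) hI)

end Occurrence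

/-! ### Alon–Tarsi implies the column Latin square conjecture (Huang–Rota; Kumar Rem. 4.5) -/

section HuangRota

variable {n : ℕ}

/-- The row permutations `j ↦ L_{ij}` of a Latin square. [cite: BurgisserHuttenhainIkenmeyer2017, §1.1 (sign of a latin square)] -/
def rowPerm (L : Fin n → Fin n → Fin n) (h : IsLatinSquare L) (i : Fin n) : Perm (Fin n) :=
  Equiv.ofBijective (L i) (h.1 i)

/-- The column permutations `i ↦ L_{ij}` of a Latin square. [cite: BurgisserHuttenhainIkenmeyer2017, §1.1 (sign of a latin square)] -/
def colPerm (L : Fin n → Fin n → Fin n) (h : IsLatinSquare L) (j : Fin n) : Perm (Fin n) :=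
  Equiv.ofBijective (fun i => L i j) (h.2 j)

/-- Unfolding lemma for `rowPerm`. [folklore] -/
@[simp] theorem rowPerm_apply (L : Fin n → Fin n → Fin n) (h : IsLatinSquare L) (i j : Fin n) :
    rowPerm L h i j = L i j := rfl

/-- Unfolding lemma for `colPerm`. [folklore] -/
@[simp] theorem colPerm_apply (L : Fin n → Fin n → Fin n) (h : IsLatinSquare L) (i j : Fin n) :
    colPerm L h j i = L i j := rfl

/-- **The column sign `ε_C(L) = ∏_j sgn(i ↦ L_{ij})`** of a Latin square (Kumar's column-even /
column-odd, Def. 4.1 with `i = m`). [cite: Kumar2015, Def. 4.1 and Conj. 4.3] -/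
def colSign (L : Fin n → Fin n → Fin n) (h : IsLatinSquare L) : ℤˣ :=
  ∏ j, Perm.sign (colPerm L h j)

/-- **The row-inverse parastrophe `L*`**: `L* i s = j ↔ L i j = s` (each row permutation replaced
by its inverse; rows stay permutations, the columns of `L*` are the symbol permutations of `L`).
[folklore] -/
def rowInv (L : Fin n → Fin n → Fin n) (h : IsLatinSquare L) : Fin n → Fin n → Fin n :=
  fun i s => (rowPerm L h i).symm s

/-- Defining property of `L*`. [folklore] -/
theorem rowInv_spec (L : Fin n → Fin n → Fin n) (h : IsLatinSquare L) (i s : Fin n) :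
    L i (rowInv L h i s) = s :=
  Equiv.apply_symm_apply (rowPerm L h i) s

/-- `L* i s = j ↔ L i j = s`. [folklore] -/
theorem rowInv_apply_eq_iff (L : Fin n → Fin n → Fin n) (h : IsLatinSquare L) (i s j : Fin n) :
    rowInv L h i s = j ↔ L i j = s := by
  rw [rowInv, Equiv.symm_apply_eq]
  exact ⟨fun h' => h'.symm, fun h' => h'.symm⟩

/-- `L*` is a Latin square. [folklore] -/
theorem isLatinSquare_rowInv (L : Fin n → Fin n → Fin n) (h : IsLatinSquare L) :
    IsLatinSquare (rowInv L h) := by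
  refine ⟨fun i => (rowPerm L h i).symm.bijective, fun s => ?_⟩
  apply Finite.injective_iff_bijective.mp
  intro i i' hii'
  dsimp only at hii'
  have h1 := rowInv_spec L h i s
  rw [hii'] at h1
  have h2 := rowInv_spec L h i' s
  exact (h.2 _).1 (h1.trans h2.symm)

/-- `L** = L`. [folklore] -/
theorem rowInv_rowInv (L : Fin n → Fin n → Fin n) (h : IsLatinSquare L) :
    rowInv (rowInv L h) (isLatinSquare_rowInv L h) = L := by
  funext i j
  rw [rowInv_apply_eq_iff, rowInv_apply_eq_iff]

/-- **The three-parities identity `ε_C(L*) = sgn(τ) · ε_R(L) ε_C(L)`**, `τ` the coordinate swap on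
`[n] × [n]` (i.e. row parity + column parity + symbol parity `≡ \binom{n}{2}`, the column sign of `L*`
being the symbol sign of `L`). Proof by permutations of the cells: with `α(i,j) = (i, L_{ij})`
(`sgn α = ε_R`), `β(i,j) = (L_{ij}, j)` (`sgn β = ε_C`) and `β*` the same for `L*`
(`sgn β* = ε_C(L*)`), one has `β ∘ α⁻¹ = τ ∘ β*`. The relation between the three parities is
classical ("rediscovered numerous times"). [cite: FranceticHerkeWanless2018, (1.1) and Lemma 2.6] -/
theorem colSign_rowInv (L : Fin n → Fin n → Fin n) (h : IsLatinSquare L) :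
    colSign (rowInv L h) (isLatinSquare_rowInv L h) =
      Perm.sign (Equiv.prodComm (Fin n) (Fin n)) * latinSign L h := by
  -- the cells permutations
  set α : Perm (Fin n × Fin n) := Equiv.prodCongrRight (rowPerm L h) with hα
  set β : Perm (Fin n × Fin n) := Equiv.prodCongrLeft (colPerm L h) with hβ
  set β' : Perm (Fin n × Fin n) :=
    Equiv.prodCongrLeft (colPerm (rowInv L h) (isLatinSquare_rowInv L h)) with hβ'
  have key : β * α⁻¹ = (Equiv.prodComm (Fin n) (Fin n) : Perm (Fin n × Fin n)) * β' := by
    refine Equiv.ext fun x => ?_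
    obtain ⟨i, s⟩ := x
    simp only [Perm.coe_mul, Function.comp_apply]
    rw [Perm.inv_def, hα, hβ, hβ']
    simp only [Equiv.prodCongrRight, Equiv.prodCongrLeft, Equiv.coe_fn_symm_mk, Equiv.coe_fn_mk,
      Equiv.prodComm_apply, Prod.swap_prod_mk, colPerm_apply]
    refine Prod.ext ?_ rfl
    exact rowInv_spec L h i s
  have hsign := congrArg Perm.sign key
  rw [Perm.sign_mul, Perm.sign_mul, Perm.sign_inv, hα, hβ, hβ', Perm.sign_prodCongrRight,
    Perm.sign_prodCongrLeft, Perm.sign_prodCongrLeft] at hsign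
  rw [colSign, latinSign]
  -- `sgn(τ)² = 1`
  have h2 : (∏ j, Perm.sign (colPerm (rowInv L h) (isLatinSquare_rowInv L h) j)) =
      Perm.sign (Equiv.prodComm (Fin n) (Fin n)) *
        ((∏ k, Perm.sign (colPerm L h k)) * ∏ k, Perm.sign (rowPerm L h k)) := by
    rw [hsign, ← mul_assoc, Int.units_mul_self, one_mul]
  rw [h2, mul_comm (∏ k, Perm.sign (colPerm L h k))]
  rfl

/-- **Huang–Rota, in the direction needed (Kumar Rem. 4.5): the column-signed count of Latin
squares of order `n` is `sgn(τ) · (♯ELS(n) − ♯OLS(n))`**, the Alon–Tarsi signed count; reindex the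
Alon–Tarsi sum by the involution `L ↦ L*` and use `colSign_rowInv`. (Huang–Rota prove the
equivalence of the Alon–Tarsi conjecture with their column Latin square conjecture.)
[cite: HuangRota1994, Thm. 3 (as cited in Kumar 2015, Rem. 4.5)] -/
theorem sum_colSign_eq [Fintype {L : Fin n → Fin n → Fin n // IsLatinSquare L}] :
    ∑ L : {L : Fin n → Fin n → Fin n // IsLatinSquare L}, ((colSign L.1 L.2 : ℤˣ) : ℤ) =
      ((Perm.sign (Equiv.prodComm (Fin n) (Fin n)) : ℤˣ) : ℤ) *
        ∑ L : {L : Fin n → Fin n → Fin n // IsLatinSquare L}, ((latinSign L.1 L.2 : ℤˣ) : ℤ) := by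
  -- reindex by the involution `L ↦ L*`
  let star : {L : Fin n → Fin n → Fin n // IsLatinSquare L} →
      {L : Fin n → Fin n → Fin n // IsLatinSquare L} :=
    fun L => ⟨rowInv L.1 L.2, isLatinSquare_rowInv L.1 L.2⟩
  have hstar : Function.Involutive star := fun L => Subtype.ext (rowInv_rowInv L.1 L.2)
  rw [Finset.mul_sum]
  have h1 : ∀ L : {L : Fin n → Fin n → Fin n // IsLatinSquare L},
      ((Perm.sign (Equiv.prodComm (Fin n) (Fin n)) : ℤˣ) : ℤ) * ((latinSign L.1 L.2 : ℤˣ) : ℤ) =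
        ((colSign (star L).1 (star L).2 : ℤˣ) : ℤ) := fun L => by
    change _ = ((colSign (rowInv L.1 L.2) (isLatinSquare_rowInv L.1 L.2) : ℤˣ) : ℤ)
    rw [colSign_rowInv, Units.val_mul]
  simp only [h1]
  exact (Equiv.sum_comp (hstar.toPerm star)
    (fun L : {L : Fin n → Fin n → Fin n // IsLatinSquare L} => ((colSign L.1 L.2 : ℤˣ) : ℤ))).symm

/-- For a Latin square, Kumar's inversion-product column sign `ε_c` is the product of the signatures
of the column permutations. [cite: Kumar2015, Def. 4.1] -/
theorem rectColSign_eq_colSign (L : Fin n → Fin n → Fin n) (h : IsLatinSquare L) :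
    rectColSign L = colSign L h := by
  unfold rectColSign colSign
  refine Finset.prod_congr rfl fun j _ => ?_
  exact seqSign_coe_perm (colPerm L h j)

/-- Latin squares are the Latin `(n,n)`-rectangles. [cite: Kumar2015, Def. 4.1] -/
theorem isLatinRect_iff_isLatinSquare (L : Fin n → Fin n → Fin n) :
    IsLatinRect L ↔ IsLatinSquare L :=
  ⟨fun h => ⟨h.1, fun j => Finite.injective_iff_bijective.mp (h.2 j)⟩,
    fun h => ⟨h.1, fun j => (h.2 j).1⟩⟩

/-- **Alon–Tarsi for `n` ⇔ `♯CELS(n) ≠ ♯COLS(n)`** (Huang–Rota; Kumar Rem. 4.5: "their column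
Latin `(m,m)`-square conjecture is equivalent to the (full) Latin `(m,m)`-square conjecture given by
Alon-Tarsi"), with the tree's `AlonTarsiConjecture n` (signed count of `NotViaSaturations.lean`) and
Kumar's `latinColCount n`. [cite: Kumar2015, Rem. 4.5] -/
theorem latinColCount_ne_zero_iff (n : ℕ) : latinColCount n ≠ 0 ↔ AlonTarsiConjecture n := by
  classical
  unfold latinColCount AlonTarsiConjecture
  rw [Finset.sum_subtype (p := fun L : Fin n → Fin n → Fin n => IsLatinSquare L)
    (univ.filter fun R : Fin n → Fin n → Fin n => IsLatinRect R)
    (fun L => by rw [Finset.mem_filter, isLatinRect_iff_isLatinSquare]; simp)]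
  have h1 : ∀ L : {L : Fin n → Fin n → Fin n // IsLatinSquare L},
      ((rectColSign L.1 : ℤˣ) : ℤ) = ((colSign L.1 L.2 : ℤˣ) : ℤ) := fun L => by
    rw [rectColSign_eq_colSign L.1 L.2]
  simp only [h1]
  rw [sum_colSign_eq]
  refine ⟨fun h h0 => h (by rw [h0, mul_zero]), fun h h0 => h ?_⟩
  rcases mul_eq_zero.mp h0 with h2 | h2
  · exact absurd h2 (Units.ne_zero _)
  · convert h2

end HuangRota

/-! ### The weights `m δ_i` and the column decomposition of `m λ` (Kumar Cor. 6.2) -/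

section Weights

variable {m : ℕ}

/-- The weight `m · (1^i) = (m, …, m, 0, …, 0)` (`i` entries `m`) of `GL_{m²}` in the partition
coordinates of `detOccWeights`: the rectangle `i × m = m δ_i` (BHI: `nλ` with `λ = (1^i)`; Kumar:
`m δ_i`). [cite: Kumar2015, Cor. 6.2] -/
def rectColWeight (m i : ℕ) : Weight (Fin (m * m)) := fun r => if (r : ℕ) < i then (m : ℤ) else 0

/-- The dual of `m δ_i`, transported to the matrix letters, is `rectWeight m t` for the top `i`
letters `t` (`-m` on them, `0` elsewhere). [folklore] -/
theorem dual_rectColWeight_toMatIdx (m i : ℕ) (hi : i ≤ m * m) :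
    (Weight.dual (rectColWeight m i)).toMatIdx = rectWeight m (topLetters m i hi) := by
  classical
  funext x
  obtain ⟨r, rfl⟩ := (matIdxEquiv m).surjective x
  rw [Weight.toMatIdx, OrderIso.symm_apply_apply, Weight.dual, rectColWeight, rectWeight]
  have hmem : matIdxEquiv m r ∈ Set.range (topLetters m i hi) ↔ m * m - i ≤ (r : ℕ) := by
    constructor
    · rintro ⟨a, ha⟩
      have := congrArg (fun y => (((matIdxEquiv m).symm y : Fin (m * m)) : ℕ)) ha
      simp only [topLetters, OrderIso.symm_apply_apply] at this
      omega
    · intro hle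
      exact ⟨⟨r - (m * m - i), by omega⟩, by
        unfold topLetters; congr 1; apply Fin.ext; simp only; omega⟩
  have hrev : ((Fin.rev r : Fin (m * m)) : ℕ) = m * m - 1 - r := by simp [Fin.rev]; omega
  simp only [hmem, hrev]
  have hr : (r : ℕ) < m * m := r.2
  by_cases h1 : m * m - i ≤ (r : ℕ)
  · rw [if_pos h1, if_pos (by omega)]
  · rw [if_neg h1, if_neg (by omega), neg_zero]

/-- **`m δ_i ∈ S(Det_m)` for `i ≤ m`** (Kumar Thm. 6.1 in the monoid `detOccWeights m`), given
`♯CELS(m) ≠ ♯COLS(m)`. [cite: Kumar2015, Thm. 6.1] -/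
theorem rectColWeight_mem_detOccWeights (hm : latinColCount m ≠ 0) {i : ℕ} (hi : i ≤ m) :
    rectColWeight m i ∈ detOccWeights m := by
  have hiN : i ≤ m * m := hi.trans (Nat.le_mul_self m)
  rw [mem_detOccWeights_iff, dual_rectColWeight_toMatIdx m i hiN]
  exact hasHighestWeight_detOrbitRep_rectWeight m i hiN hi hm

/-- Telescoping for an antitone sequence vanishing at `m`:
`a r = ∑_{i < m} (a i − a (i+1)) · [r ≤ i]` for every `r`. [folklore] -/
theorem eq_sum_range_tsub_mul_indicator {a : ℕ → ℕ} (ha : Antitone a) (hm : a m = 0) (r : ℕ) :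
    (a r : ℤ) = ∑ i ∈ Finset.range m, ((a i - a (i + 1) : ℕ) : ℤ) * (if r ≤ i then 1 else 0) := by
  by_cases hr : m ≤ r
  · have : a r = 0 := Nat.eq_zero_of_le_zero (hm ▸ ha hr)
    rw [this, Nat.cast_zero]
    refine (Finset.sum_eq_zero fun i hi => ?_).symm
    rw [Finset.mem_range] at hi
    rw [if_neg (by omega), mul_zero]
  · push Not at hr
    -- split the range at `r`
    rw [← Finset.sum_range_add_sum_Ico _ hr.le]
    have h0 : ∑ i ∈ Finset.range r, ((a i - a (i + 1) : ℕ) : ℤ) * (if r ≤ i then 1 else 0) = 0 :=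
      Finset.sum_eq_zero fun i hi => by
        rw [Finset.mem_range] at hi
        rw [if_neg (by omega), mul_zero]
    have h1 : ∑ i ∈ Finset.Ico r m, ((a i - a (i + 1) : ℕ) : ℤ) * (if r ≤ i then 1 else 0) =
        ∑ i ∈ Finset.Ico r m, ((a i : ℤ) - a (i + 1)) :=
      Finset.sum_congr rfl fun i hi => by
        rw [Finset.mem_Ico] at hi
        rw [if_pos hi.1, mul_one, Nat.cast_sub (ha (Nat.le_succ i))]
    rw [h0, zero_add, h1, Finset.sum_Ico_eq_sum_range]
    have h2 := Finset.sum_range_sub' (fun k => (a (r + k) : ℤ)) (m - r)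
    simp only [add_zero] at h2
    rw [show r + (m - r) = m by omega, hm, Nat.cast_zero, sub_zero] at h2
    rw [← h2]
    refine Finset.sum_congr rfl fun k _ => ?_
    rw [add_assoc]

/-- **The column decomposition `m λ = ∑_{i<m} (λ_{i+1} − λ_{i+2}) · (m δ_{i+1})`** of the stretched
weight of a partition `λ` with at most `m` parts (Kumar Cor. 6.2: "`λ = ∑ n_i δ_i`", so that
`P̃_λ = ∏ P̃_i^{n_i}` has weight `m λ`), in the weight coordinates `Weight.ofPartition (m²) λ`.
[cite: Kumar2015, Cor. 6.2 (proof)] -/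
theorem smul_ofPartition_eq_sum {D : ℕ} (lam : Nat.Partition D) (hlam : lam.parts.card ≤ m) :
    m • Weight.ofPartition (m * m) lam =
      ∑ i ∈ Finset.range m,
        (lam.sortedParts.getD i 0 - lam.sortedParts.getD (i + 1) 0) • rectColWeight m (i + 1) := by
  funext r
  rw [Pi.smul_apply, Finset.sum_apply, Weight.ofPartition_apply]
  simp only [Pi.smul_apply, rectColWeight, nsmul_eq_mul]
  have hzero : lam.sortedParts.getD m 0 = 0 :=
    List.getD_eq_default _ _ (by rw [Nat.Partition.length_sortedParts]; exact hlam)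
  rw [eq_sum_range_tsub_mul_indicator (antitone_getD_sortedParts lam) hzero r, Finset.mul_sum]
  refine Finset.sum_congr rfl fun i _ => ?_
  by_cases h : (r : ℕ) ≤ i
  · rw [if_pos h, if_pos (Nat.lt_succ_of_le h)]; ring
  · rw [if_neg h, if_neg (by omega)]; ring

/-- **Discharge of `Kumar2015_stretching` (BHI Thm. 2 = Kumar Cor. 6.2).** For `m` with the
Alon–Tarsi conjecture (hence `♯CELS(m) ≠ ♯COLS(m)`, `latinColCount_ne_zero_iff`) and a partition
`λ` with at most `m` parts, `m λ = ∑_i (λ_i − λ_{i+1}) (m δ_i)` lies in the additive monoid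
`S(Det_m) = detOccWeights m` because each `m δ_i`, `1 ≤ i ≤ m`, does
(`rectColWeight_mem_detOccWeights`). The parity hypothesis of the statement is not needed.
[cite: BurgisserHuttenhainIkenmeyer2017, Thm. 2 (Kumar 2015 Cor. 6.2)] -/
theorem Kumar2015_stretching_holds : Kumar2015_stretching := by
  intro m _ hAT D lam hlam
  have hm : latinColCount m ≠ 0 := (latinColCount_ne_zero_iff m).mpr hAT
  rw [smul_ofPartition_eq_sum lam hlam]
  refine AddSubmonoid.sum_mem _ fun i hi => AddSubmonoid.nsmul_mem _ ?_ _
  rw [Finset.mem_range] at hi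
  exact rectColWeight_mem_detOccWeights hm hi

end Weights

end Literature.Barriers.ValiantsHypothesis
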